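import Summits.CriticalPhenomena.PercolationContinuityZ3.Theorems.PercNearOneGluingNoHeavyLowerTailSahiCombTriWCommonBottom
import Summits.CriticalPhenomena.PercolationContinuityZ3.Theorems.PercNearOneGluingNoHeavyLowerTailSahiCombTriWRungTwo
import Summits.CriticalPhenomena.PercolationContinuityZ3.Theorems.PercNearOneGluingNoHeavyLowerTailSahiCombTriWAntiNestedKernelProof
import Summits.CriticalPhenomena.PercolationContinuityZ3.Theorems.PercNearOneGluingNoHeavyLowerTailSahiCombFourChainIneq

/-!
# `TRI_W(2) ≥ 0` on the stratum `F x ⊆ G x for every index x (one family dominated by the other)` — a machine-found, kernel-checked pointwise certificate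

Support file of the one-cut programme (crux `NoHeavyLowerTail`, stmt-CriticalPhenomena-4575; cell `prim-masterthm`, seat P5 gen 27 (generator of gen 26);
memo `FROM-prim-masterthm-p5-g27-JOINT-LATTICE-CONE.md`).  Target `FiveUpSet.TriWIneq` (`…SahiCombTriWGeneral`), OPEN for index cubes of dimension `a ≥ 2`.
At `a = 2` the pair reduction `LatticeFiveUpSet.triW_nonneg_of_pair_nonneg` reduces it to
`0 ≤ triWOne c P F₀ F₁ G₀ G₁ + triWOne c P Fp Fq Gp Gq` for two diamonds of up-sets `F₀ ⊆ Fp, Fq ⊆ F₁`, `G₀ ⊆ Gp, Gq ⊆ G₁`.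
This file proves that inequality on the stratum `F x ⊆ G x for every index x (one family dominated by the other)` by a POINTWISE CERTIFICATE: `2` times the sum dominates a non-negative integer
combination of `5` instances of tree theorems (Kleitman's antipodal lemma `card_inter_refl_le`, the five-up-set theorem `fiveUpSetIneq_holds`,
the top-fibre inequality `topFibre_le`, the rung theorem `rung_two_le`, the six-up-set inequality `sixUpSet_le`, the four-chain inequalities
`fourChainIneq_holds` / `antiNestedChainHall_holds`, the bot-empty stratum `inner_pair_le_of_bot_empty`), and the remainder is a sum over the points
`w` of the cube of a function of the positions of `w, wᶜ` in the two diamonds and in `P` that is non-negative in every case allowed by the stratum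
(kernel `decide`).  The certificate was found by an LP over the antipodal pair types of the stratum (column generation over ≈ 2·10⁵ atom instances
including the full joint-lattice Kleitman cone; P5 gen 27, kit j195199); the SAME LP is INFEASIBLE for the unrestricted statement (fooling value `9/35`)
and for the whole half-chain stratum `G{a} ⊆ G{b}` (`91/522`), so no certificate of this shape proves them.
HONEST LABEL: one new unconditional stratum of `TriWIneq` at `a = 2`; `TriWIneq` itself remains OPEN. [this work]
-/

namespace Summit.CriticalPhenomena.PercolationContinuityZ3.Theorems

namespace FiveUpSet

open Finset LatticeFiveUpSet

variable {γ : Type} [DecidableEq γ] [Fintype γ]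


set_option synthInstance.maxHeartbeats 400000 in
set_option synthInstance.maxSize 4096 in
set_option maxHeartbeats 800000 in
/-- **`TRI_W(2) ≥ 0` on the stratum `F x ⊆ G x for every index x (one family dominated by the other)`, pair form** (pointwise certificate: `5` atom instances, multiplier `2`,
remainder non-negative on every local type allowed by the stratum; found by LP column generation, P5 gen 27). [this work] -/
theorem inner_pair_le_of_fibrewise_le (P F₀ Fp Fq F₁ G₀ Gp Gq G₁ : Finset (Finset γ)) (hP : IsUpperSet (P : Set (Finset γ)))
    (hF₀ : IsUpperSet (F₀ : Set (Finset γ))) (hFp : IsUpperSet (Fp : Set (Finset γ))) (hFq : IsUpperSet (Fq : Set (Finset γ)))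
    (hF₁ : IsUpperSet (F₁ : Set (Finset γ))) (hG₀ : IsUpperSet (G₀ : Set (Finset γ))) (hGp : IsUpperSet (Gp : Set (Finset γ)))
    (hGq : IsUpperSet (Gq : Set (Finset γ))) (hG₁ : IsUpperSet (G₁ : Set (Finset γ)))
    (hF0p : F₀ ⊆ Fp) (hF0q : F₀ ⊆ Fq) (hFp1 : Fp ⊆ F₁) (hFq1 : Fq ⊆ F₁)
    (hG0p : G₀ ⊆ Gp) (hG0q : G₀ ⊆ Gq) (hGp1 : Gp ⊆ G₁) (hGq1 : Gq ⊆ G₁) (hFG0 : F₀ ⊆ G₀) (hFGp : Fp ⊆ Gp) (hFGq : Fq ⊆ Gq) (hFG1 : F₁ ⊆ G₁) :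
    0 ≤ triWOne (complEquiv γ) P F₀ F₁ G₀ G₁ + triWOne (complEquiv γ) P Fp Fq Gp Gq := by
  rw [triWOne_expand, triWOne_expand]
  have hW : IsUpperSet ((univ : Finset (Finset γ)) : Set (Finset γ)) := by rw [coe_univ]; exact isUpperSet_univ
  have hMF : IsUpperSet ((Fp ∩ Fq : Finset (Finset γ)) : Set (Finset γ)) := by rw [coe_inter]; exact hFp.inter hFq
  have hMG : IsUpperSet ((Gp ∩ Gq : Finset (Finset γ)) : Set (Finset γ)) := by rw [coe_inter]; exact hGp.inter hGq
  have hJF : IsUpperSet ((Fp ∪ Fq : Finset (Finset γ)) : Set (Finset γ)) := by rw [coe_union]; exact hFp.union hFq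
  have hJG : IsUpperSet ((Gp ∪ Gq : Finset (Finset γ)) : Set (Finset γ)) := by rw [coe_union]; exact hGp.union hGq
  have h1 := fiveUpSetIneq_holds γ (P ∩ Gq) F₀ F₁ G₀ G₁ (by rw [coe_inter]; exact (hP).inter hGq) hF₀ hF₁ hG₀ hG₁ (hF0p.trans hFp1) (hG0p.trans hGp1)
  have h1' : 0 ≤ (((P ∩ Gq) ∩ F₁ ∩ G₁).card : ℤ) + (((P ∩ Gq) ∩ F₀ ∩ G₀).card : ℤ) - (((P ∩ Gq) ∩ F₁ ∩ refl G₀).card : ℤ) - (((P ∩ Gq) ∩ refl F₀ ∩ G₁).card : ℤ) - (((P ∩ Gq) ∩ refl (F₁ \ F₀) ∩ refl (G₁ \ G₀)).card : ℤ) := by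
    have := h1; omega
  have h2 := topFibre_le P ∅ Fp Gq (Gp ∪ Gq) hP isUpperSet_empty hFp hGq hJG (empty_subset _) subset_union_right
  have h2' : 0 ≤ 2 * ((P ∩ Fp ∩ (Gp ∪ Gq)).card : ℤ) - ((P ∩ (Gp ∪ Gq) ∩ refl ∅).card : ℤ) - ((P ∩ Fp ∩ refl Gq).card : ℤ) - ((P ∩ refl (Fp ∩ ((Gp ∪ Gq) \ Gq))).card : ℤ) - ((P ∩ refl ((Fp \ ∅) ∩ (Gp ∪ Gq))).card : ℤ) := by
    have := h2; omega
  have h3 := topFibre_le P F₀ Fq Gp G₁ hP hF₀ hFq hGp hG₁ hF0q hGp1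
  have h3' : 0 ≤ 2 * ((P ∩ Fq ∩ G₁).card : ℤ) - ((P ∩ G₁ ∩ refl F₀).card : ℤ) - ((P ∩ Fq ∩ refl Gp).card : ℤ) - ((P ∩ refl (Fq ∩ (G₁ \ Gp))).card : ℤ) - ((P ∩ refl ((Fq \ F₀) ∩ G₁)).card : ℤ) := by
    have := h3; omega
  have h4 := topFibre_le P (Fp ∩ Fq) F₁ ∅ G₁ hP hMF hF₁ isUpperSet_empty hG₁ (inter_subset_left.trans hFp1) (empty_subset _)
  have h4' : 0 ≤ 2 * ((P ∩ F₁ ∩ G₁).card : ℤ) - ((P ∩ G₁ ∩ refl (Fp ∩ Fq)).card : ℤ) - ((P ∩ F₁ ∩ refl ∅).card : ℤ) - ((P ∩ refl (F₁ ∩ (G₁ \ ∅))).card : ℤ) - ((P ∩ refl ((F₁ \ (Fp ∩ Fq)) ∩ G₁)).card : ℤ) := by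
    have := h4; omega
  have h5 := topFibre_le (P ∩ G₁) F₀ Fp Gq (Gp ∪ Gq) (by rw [coe_inter]; exact (hP).inter hG₁) hF₀ hFp hGq hJG hF0p subset_union_right
  have h5' : 0 ≤ 2 * (((P ∩ G₁) ∩ Fp ∩ (Gp ∪ Gq)).card : ℤ) - (((P ∩ G₁) ∩ (Gp ∪ Gq) ∩ refl F₀).card : ℤ) - (((P ∩ G₁) ∩ Fp ∩ refl Gq).card : ℤ) - (((P ∩ G₁) ∩ refl (Fp ∩ ((Gp ∪ Gq) \ Gq))).card : ℤ) - (((P ∩ G₁) ∩ refl ((Fp \ F₀) ∩ (Gp ∪ Gq))).card : ℤ) := by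
    have := h5; omega
  have hR : 0 ≤ 2 * ((2 * (((P ∩ F₀ ∩ G₀).card : ℤ) + ((P ∩ F₁ ∩ G₁).card : ℤ)) - (((P ∩ refl F₀ ∩ G₁).card : ℤ) + ((P ∩ refl F₁ ∩ G₀).card : ℤ)) - (((P ∩ F₀ ∩ refl G₁).card : ℤ) + ((P ∩ F₁ ∩ refl G₀).card : ℤ)) - (((P ∩ refl F₀ ∩ refl G₀).card : ℤ) + ((P ∩ refl F₁ ∩ refl G₁).card : ℤ)) + (((P ∩ refl F₀ ∩ refl G₁).card : ℤ) + ((P ∩ refl F₁ ∩ refl G₀).card : ℤ))) + (2 * (((P ∩ Fp ∩ Gp).card : ℤ) + ((P ∩ Fq ∩ Gq).card : ℤ)) - (((P ∩ refl Fp ∩ Gq).card : ℤ) + ((P ∩ refl Fq ∩ Gp).card : ℤ)) - (((P ∩ Fp ∩ refl Gq).card : ℤ) + ((P ∩ Fq ∩ refl Gp).card : ℤ)) - (((P ∩ refl Fp ∩ refl Gp).card : ℤ) + ((P ∩ refl Fq ∩ refl Gq).card : ℤ)) + (((P ∩ refl Fp ∩ refl Gq).card : ℤ) + ((P ∩ refl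 Fq ∩ refl Gp).card : ℤ)))) - (2 * ((((P ∩ Gq) ∩ F₁ ∩ G₁).card : ℤ) + (((P ∩ Gq) ∩ F₀ ∩ G₀).card : ℤ) - (((P ∩ Gq) ∩ F₁ ∩ refl G₀).card : ℤ) - (((P ∩ Gq) ∩ refl F₀ ∩ G₁).card : ℤ) - (((P ∩ Gq) ∩ refl (F₁ \ F₀) ∩ refl (G₁ \ G₀)).card : ℤ)) + 1 * (2 * ((P ∩ Fp ∩ (Gp ∪ Gq)).card : ℤ) - ((P ∩ (Gp ∪ Gq) ∩ refl ∅).card : ℤ) - ((P ∩ Fp ∩ refl Gq).card : ℤ) - ((P ∩ refl (Fp ∩ ((Gp ∪ Gq) \ Gq))).card : ℤ) - ((P ∩ refl ((Fp \ ∅) ∩ (Gp ∪ Gq))).card : ℤ)) + 2 * (2 * ((P ∩ Fq ∩ G₁).card : ℤ) - ((P ∩ G₁ ∩ refl F₀).card : ℤ) - ((P ∩ Fq ∩ refl Gp).card : ℤ) - ((P ∩ refl (Fq ∩ (G₁ \ Gp))).card : ℤ) - ((P ∩ refl ((Fq \ F₀) ∩ G₁)).card : ℤ)) + 1 * (2 *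 ((P ∩ F₁ ∩ G₁).card : ℤ) - ((P ∩ G₁ ∩ refl (Fp ∩ Fq)).card : ℤ) - ((P ∩ F₁ ∩ refl ∅).card : ℤ) - ((P ∩ refl (F₁ ∩ (G₁ \ ∅))).card : ℤ) - ((P ∩ refl ((F₁ \ (Fp ∩ Fq)) ∩ G₁)).card : ℤ)) + 1 * (2 * (((P ∩ G₁) ∩ Fp ∩ (Gp ∪ Gq)).card : ℤ) - (((P ∩ G₁) ∩ (Gp ∪ Gq) ∩ refl F₀).card : ℤ) - (((P ∩ G₁) ∩ Fp ∩ refl Gq).card : ℤ) - (((P ∩ G₁) ∩ refl (Fp ∩ ((Gp ∪ Gq) \ Gq))).card : ℤ) - (((P ∩ G₁) ∩ refl ((Fp \ F₀) ∩ (Gp ∪ Gq))).card : ℤ))) := by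
    simp only [card_eq_univ_sum]
    simp only [mem_inter, mem_refl, mem_union, mem_sdiff, Finset.notMem_empty]
    simp only [mul_add, mul_sub]
    simp only [Finset.mul_sum, ← Finset.sum_add_distrib, ← Finset.sum_sub_distrib]
    refine Finset.sum_nonneg (fun w _ => ?_)
    obtain ⟨s₁, a0, ap, aq, a1⟩ := diamond_pos hF0p hF0q hFp1 hFq1 w
    obtain ⟨s₂, b0, bp, bq, b1⟩ := diamond_pos hG0p hG0q hGp1 hGq1 w
    obtain ⟨s₃, c0, cp, cq, c1⟩ := diamond_pos hF0p hF0q hFp1 hFq1 wᶜ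
    obtain ⟨s₄, d0, dp, dq, d1⟩ := diamond_pos hG0p hG0q hGp1 hGq1 wᶜ
    have e0 : s₁ = 5 → s₂ = 5 := fun h => b0.mp (hFG0 (a0.mpr h))
    have eP : (s₁ = 2 ∨ s₁ = 4 ∨ s₁ = 5) → (s₂ = 2 ∨ s₂ = 4 ∨ s₂ = 5) := fun h => bp.mp (hFGp (ap.mpr h))
    have eQ : (s₁ = 3 ∨ s₁ = 4 ∨ s₁ = 5) → (s₂ = 3 ∨ s₂ = 4 ∨ s₂ = 5) := fun h => bq.mp (hFGq (aq.mpr h))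
    have e1 : s₁ ≠ 0 → s₂ ≠ 0 := fun h => b1.mp (hFG1 (a1.mpr h))
    have f0 : s₃ = 5 → s₄ = 5 := fun h => d0.mp (hFG0 (c0.mpr h))
    have fP : (s₃ = 2 ∨ s₃ = 4 ∨ s₃ = 5) → (s₄ = 2 ∨ s₄ = 4 ∨ s₄ = 5) := fun h => dp.mp (hFGp (cp.mpr h))
    have fQ : (s₃ = 3 ∨ s₃ = 4 ∨ s₃ = 5) → (s₄ = 3 ∨ s₄ = 4 ∨ s₄ = 5) := fun h => dq.mp (hFGq (cq.mpr h))
    have f1 : s₃ ≠ 0 → s₄ ≠ 0 := fun h => d1.mp (hFG1 (c1.mpr h))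
    simp only [a0, ap, aq, a1, b0, bp, bq, b1, c0, cp, cq, c1, d0, dp, dq, d1]
    clear a0 ap aq a1 b0 bp bq b1 c0 cp cq c1 d0 dp dq d1
    by_cases hp : w ∈ P <;> simp only [hp] <;> (revert s₁ s₂ s₃ s₄; decide)
  linarith [hR, h1', h2', h3', h4', h5']

/-- **STRATUM of `TRI_W(2) ≥ 0` (unconditional): one family is DOMINATED by the other fibrewise (`F x ⊆ G x` for every index `x`).**  Index cube with two atoms `a ≠ b`, up-set `P`, monotone families `F, G` of up-sets of a
finite cube: `0 ≤ triW P F G`.  Pair reduction `LatticeFiveUpSet.triW_nonneg_of_pair_nonneg` + `inner_pair_le_of_fibrewise_le`. [this work] -/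
theorem triW_nonneg_of_fibrewise_le {β : Type} [DecidableEq β] [Fintype β] {a b : β} (hab : a ≠ b) (hu : (univ : Finset β) = {a, b})
    (P : Finset (Finset γ)) (F G : Finset β → Finset (Finset γ))
    (hP : IsUpperSet (P : Set (Finset γ))) (hF : ∀ x, IsUpperSet (F x : Set (Finset γ))) (hG : ∀ x, IsUpperSet (G x : Set (Finset γ)))
    (hFm : Monotone F) (hGm : Monotone G) (hFG : ∀ x, F x ⊆ G x) : 0 ≤ triW P F G := by
  refine LatticeFiveUpSet.triW_nonneg_of_pair_nonneg hab hu P F G ?_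
  exact inner_pair_le_of_fibrewise_le P (F ∅) (F {a}) (F {b}) (F univ) (G ∅) (G {a}) (G {b}) (G univ) hP (hF ∅) (hF {a}) (hF {b}) (hF univ)
    (hG ∅) (hG {a}) (hG {b}) (hG univ) (hFm (empty_subset _)) (hFm (empty_subset _)) (hFm (subset_univ _)) (hFm (subset_univ _))
    (hGm (empty_subset _)) (hGm (empty_subset _)) (hGm (subset_univ _)) (hGm (subset_univ _)) (hFG ∅) (hFG {a}) (hFG {b}) (hFG univ)

end FiveUpSet

end Summit.CriticalPhenomena.PercolationContinuityZ3.Theorems
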